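import Mathlib
import Summits.RiemannHypothesis.RiemannHypothesis.Theorems.WeilFarFloorEnvelope
import Literature.Analysis.FunctionSpaces.SquaredBessel
import HarnessLib

/-!
# The box envelope: an `h`-regular majorant of every window function (increments `≤ (2|t|/h)·∫g²`)

Helper file (`--supports stmt-RiemannHypothesis-0098`, lead-track anchor: Weil-positivity window ladder, format-C far bound),
pure proofs, RH-free.  Seat rh-explicit-weil-1 gen11/gen12 (memo `run/shared/lean/pub/rh-explicit/rh-explicit-weil-1/FORMAT-K3.md`
§12.6, §13); sequel of `WeilFarFloorEnvelope` (RMS-envelope domination `Q_a(g) ≤ Q_{a+h}(G)`, `∫G² = ∫g²`).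

§1 The envelope inherits the weight's regularity: `∫ (G(x+t) − G(x))² ≤ (∫|φ(z+t) − φ(z)|dz)·∫g²` (`integral_sq_envelope_sub_le`;
`(√A − √B)² ≤ |A − B|` and Tonelli).  §2 The box weight `φ_h = 1_{[−h,h]}/(2h)` (`box_weight`) has `L¹`-modulus `≤ 2|t|/h`
(`box_weight_modulus`), so its envelope satisfies `∫ (G(x+t) − G(x))² ≤ min(2, 2|t|/h)·∫g²` (`boxEnvelope_increment_le`).
§3 Package (`exists_boxEnvelope`): every real measurable bounded `g` vanishing off `[−a, a]` is dominated, for every `h > 0`, by an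
admissible `G ≥ 0` on `[−(a+h), a+h]` with `∫G² = ∫g²`, `Q_a(g) ≤ Q_{a+h}(G)` and `∫(G(x+t) − G(x))² ≤ (|t|/(h/2))·∫G²` — a member of the
linear-modulus class of `WeilFarFloorModulusClassRH` at scale `h/2`.  With the cosh-split ceiling this gives the floor law under RH
(`WeilFarFloorLawSharpRH`).  Standard axioms only.
-/

set_option linter.dupNamespace false
set_option autoImplicit false

noncomputable section

open MeasureTheory Set Filter
open scoped Real Topology ArithmeticFunction.vonMangoldt

namespace Summit.RiemannHypothesis.RiemannHypothesis.Theorems.WeilFormatC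

namespace FloorEnvelope

open Literature.NumberTheory.LFunctions

variable {a h : ℝ} {g φ : ℝ → ℝ} {C Cφ : ℝ}

/-! ## §1 The envelope's increments through the weight's `L¹`-modulus -/

/-- The shifted-weight difference `ψ_t(z) = |φ(z + t) − φ(z)|` is an admissible weight datum: measurable, nonnegative, bounded by `2Cφ`,
vanishing off `[−(h + |t|), h + |t|]`. -/
theorem shiftWeight_admissible (hφm : Measurable φ) (hφ0 : ∀ z, 0 ≤ φ z) (hφC : ∀ z, φ z ≤ Cφ)
    (hφs : ∀ z, z ∉ Icc (-h) h → φ z = 0) (t : ℝ) :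
    Measurable (fun z ↦ |φ (z + t) - φ z|) ∧ (∀ z, 0 ≤ |φ (z + t) - φ z|) ∧ (∀ z, |φ (z + t) - φ z| ≤ 2 * Cφ) ∧
      (∀ z, z ∉ Icc (-(h + |t|)) (h + |t|) → |φ (z + t) - φ z| = 0) := by
  refine ⟨((hφm.comp (measurable_id.add_const t)).sub hφm).abs, fun z ↦ abs_nonneg _, fun z ↦ ?_, fun z hz ↦ ?_⟩
  · have h1 := hφ0 (z + t); have h2 := hφC (z + t); have h3 := hφ0 z; have h4 := hφC z
    rw [abs_le]; constructor <;> linarith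
  · have ht := abs_nonneg t
    have hz1 : z ∉ Icc (-h) h := fun hm ↦ hz ⟨by linarith [hm.1], by linarith [hm.2]⟩
    have hz2 : z + t ∉ Icc (-h) h := by
      intro hm
      refine hz ⟨?_, ?_⟩
      · have := neg_abs_le t; linarith [hm.1, le_abs_self t]
      · linarith [hm.2, neg_abs_le t]
    rw [hφs _ hz1, hφs _ hz2, sub_zero, abs_zero]

/-- The difference of squared envelopes is the weighted square with the DIFFERENCE weight:
`G²(x + t) − G²(x) = ∫ (φ(z + t) − φ(z)) g(x − z)² dz`. -/
theorem weightedSq_shift_sub (hg : Measurable g) (hC : ∀ x, |g x| ≤ C)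
    (hφm : Measurable φ) (hφ0 : ∀ z, 0 ≤ φ z) (hφC : ∀ z, φ z ≤ Cφ) (hφs : ∀ z, z ∉ Icc (-h) h → φ z = 0) (x t : ℝ) :
    (∫ z, φ z * g (x + t - z) ^ 2) - ∫ z, φ z * g (x - z) ^ 2 = ∫ z, (φ (z + t) - φ z) * g (x - z) ^ 2 := by
  have h1 : ∫ z, φ z * g (x + t - z) ^ 2 = ∫ z, φ (z + t) * g (x - z) ^ 2 := by
    have := integral_add_right_eq_self (μ := volume) (fun z ↦ φ z * g (x + t - z) ^ 2) t
    rw [← this]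
    refine integral_congr_ae (Eventually.of_forall fun z ↦ ?_)
    simp only
    ring_nf
  have i1 : Integrable (fun z ↦ φ (z + t) * g (x - z) ^ 2) := by
    have := (integrable_weight_mul_sq hg hC hφm hφ0 hφC hφs (x + t)).comp_add_right t
    refine this.congr (Eventually.of_forall fun z ↦ ?_)
    simp only; ring_nf
  have i2 : Integrable (fun z ↦ φ z * g (x - z) ^ 2) := integrable_weight_mul_sq hg hC hφm hφ0 hφC hφs x
  rw [h1, ← integral_sub i1 i2]
  refine integral_congr_ae (Eventually.of_forall fun z ↦ ?_)
  simp only; ring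

/-- **The envelope's increments are controlled by the weight's `L¹`-modulus**:
`∫ (G(x + t) − G(x))² dx ≤ (∫ |φ(z + t) − φ(z)| dz) · ∫ g²`. -/
theorem integral_sq_envelope_sub_le (hg : Measurable g) (hC : ∀ x, |g x| ≤ C) (hsupp : ∀ x, x ∉ Icc (-a) a → g x = 0)
    (hφm : Measurable φ) (hφ0 : ∀ z, 0 ≤ φ z) (hφC : ∀ z, φ z ≤ Cφ) (hφs : ∀ z, z ∉ Icc (-h) h → φ z = 0) (t : ℝ) :
    ∫ x, (Real.sqrt (∫ z, φ z * g (x + t - z) ^ 2) - Real.sqrt (∫ z, φ z * g (x - z) ^ 2)) ^ 2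
      ≤ (∫ z, |φ (z + t) - φ z|) * ∫ x, g x ^ 2 := by
  obtain ⟨hψm, hψ0, hψC, hψs⟩ := shiftWeight_admissible hφm hφ0 hφC hφs t
  -- product integrability of the difference-weight square and the Tonelli evaluation
  have hF := integrable_weight_mul_sq_prod (h := h + |t|) hg hC hsupp hψm hψ0 hψC hψs
  have heval : ∫ x, ∫ z, |φ (z + t) - φ z| * g (x - z) ^ 2 = (∫ z, |φ (z + t) - φ z|) * ∫ x, g x ^ 2 := by
    rw [integral_integral_swap hF]
    have h2 : ∀ z, ∫ x, |φ (z + t) - φ z| * g (x - z) ^ 2 = |φ (z + t) - φ z| * ∫ x, g x ^ 2 := by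
      intro z
      rw [integral_const_mul]
      congr 1
      exact integral_sub_right_eq_self (μ := volume) (fun x ↦ g x ^ 2) z
    simp_rw [h2]
    rw [integral_mul_const]
  rw [← heval]
  refine integral_mono_of_nonneg (Eventually.of_forall fun x ↦ sq_nonneg _) hF.integral_prod_left
    (Eventually.of_forall fun x ↦ ?_)
  -- pointwise: `(√A − √B)² ≤ |A − B| = |∫ (φ(z+t) − φ z) g(x−z)²| ≤ ∫ |φ(z+t) − φ z| g(x−z)²`
  have hA := weightedSq_nonneg (g := g) hφ0 (x + t)
  have hB := weightedSq_nonneg (g := g) hφ0 x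
  refine (Literature.Analysis.FunctionSpaces.sq_sqrt_sub_sqrt_le hA hB).trans ?_
  rw [weightedSq_shift_sub hg hC hφm hφ0 hφC hφs x t]
  refine (abs_integral_le_integral_abs).trans (le_of_eq (integral_congr_ae (Eventually.of_forall fun z ↦ ?_)))
  simp only [abs_mul, abs_pow, sq_abs]

/-- The weight's `L¹`-modulus never exceeds `2∫φ = 2`; hence `∫ (G(x+t) − G(x))² ≤ 2∫g²` for every `t`. -/
theorem integral_sq_envelope_sub_le_two_mul (hg : Measurable g) (hC : ∀ x, |g x| ≤ C) (hsupp : ∀ x, x ∉ Icc (-a) a → g x = 0)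
    (hφm : Measurable φ) (hφ0 : ∀ z, 0 ≤ φ z) (hφC : ∀ z, φ z ≤ Cφ) (hφs : ∀ z, z ∉ Icc (-h) h → φ z = 0)
    (hφ1 : ∫ z, φ z = 1) (t : ℝ) :
    ∫ x, (Real.sqrt (∫ z, φ z * g (x + t - z) ^ 2) - Real.sqrt (∫ z, φ z * g (x - z) ^ 2)) ^ 2 ≤ 2 * ∫ x, g x ^ 2 := by
  have hφi : Integrable φ := by
    by_contra hni
    rw [integral_undef hni] at hφ1; exact zero_ne_one hφ1
  have hmod : ∫ z, |φ (z + t) - φ z| ≤ 2 := by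
    have h1 : ∫ z, |φ (z + t) - φ z| ≤ ∫ z, (φ (z + t) + φ z) := by
      refine integral_mono_of_nonneg (Eventually.of_forall fun z ↦ abs_nonneg _) ((hφi.comp_add_right t).add hφi)
        (Eventually.of_forall fun z ↦ ?_)
      have := hφ0 (z + t); have := hφ0 z
      rw [abs_le]; constructor <;> linarith
    rw [integral_add (hφi.comp_add_right t) hφi, integral_add_right_eq_self (μ := volume) φ t, hφ1] at h1
    linarith
  have hg2 : 0 ≤ ∫ x, g x ^ 2 := integral_nonneg fun x ↦ sq_nonneg _
  exact (integral_sq_envelope_sub_le hg hC hsupp hφm hφ0 hφC hφs t).trans (mul_le_mul_of_nonneg_right hmod hg2)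

/-! ## §2 The box weight and its envelope -/

/-- The box weight `φ_h = 1_{[−h,h]}/(2h)` is an admissible weight: measurable, nonnegative, bounded by `1/(2h)`, vanishing off
`[−h, h]`, total mass `1`. -/
theorem box_weight (hh : 0 < h) :
    Measurable (fun z ↦ 1 / (2 * h) * (Icc (-h) h).indicator (fun _ ↦ (1 : ℝ)) z) ∧
      (∀ z, 0 ≤ 1 / (2 * h) * (Icc (-h) h).indicator (fun _ ↦ (1 : ℝ)) z) ∧
      (∀ z, 1 / (2 * h) * (Icc (-h) h).indicator (fun _ ↦ (1 : ℝ)) z ≤ 1 / (2 * h)) ∧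
      (∀ z, z ∉ Icc (-h) h → 1 / (2 * h) * (Icc (-h) h).indicator (fun _ ↦ (1 : ℝ)) z = 0) ∧
      ∫ z, 1 / (2 * h) * (Icc (-h) h).indicator (fun _ ↦ (1 : ℝ)) z = 1 := by
  have h2h : 0 < 1 / (2 * h) := by positivity
  have hind : ∀ z, 0 ≤ (Icc (-h) h).indicator (fun _ ↦ (1 : ℝ)) z ∧ (Icc (-h) h).indicator (fun _ ↦ (1 : ℝ)) z ≤ 1 := by
    intro z; by_cases hz : z ∈ Icc (-h) h
    · rw [indicator_of_mem hz]; exact ⟨zero_le_one, le_rfl⟩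
    · rw [indicator_of_notMem hz]; exact ⟨le_rfl, zero_le_one⟩
  refine ⟨measurable_const.mul (measurable_const.indicator measurableSet_Icc), fun z ↦ mul_nonneg h2h.le (hind z).1,
    fun z ↦ ?_, fun z hz ↦ by rw [indicator_of_notMem hz, mul_zero], ?_⟩
  · calc 1 / (2 * h) * (Icc (-h) h).indicator (fun _ ↦ (1 : ℝ)) z ≤ 1 / (2 * h) * 1 :=
          mul_le_mul_of_nonneg_left (hind z).2 h2h.le
      _ = 1 / (2 * h) := mul_one _
  · rw [integral_const_mul]
    have : ∫ z, (Icc (-h) h).indicator (fun _ ↦ (1 : ℝ)) z = 2 * h := by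
      have h1 : (Icc (-h) h).indicator (fun _ ↦ (1 : ℝ)) = (Icc (-h) h).indicator 1 := rfl
      rw [h1, integral_indicator_one measurableSet_Icc, Real.volume_real_Icc_of_le (by linarith)]; ring
    rw [this]; field_simp

/-- **`L¹`-modulus of the box weight**: `∫ |φ_h(z + t) − φ_h(z)| dz ≤ 2|t|/h`. -/
theorem box_weight_modulus (hh : 0 < h) (t : ℝ) :
    ∫ z, |1 / (2 * h) * (Icc (-h) h).indicator (fun _ ↦ (1 : ℝ)) (z + t)
        - 1 / (2 * h) * (Icc (-h) h).indicator (fun _ ↦ (1 : ℝ)) z| ≤ 2 * |t| / h := by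
  have h2h : 0 < 1 / (2 * h) := by positivity
  set J₁ : Set ℝ := Icc (-h - |t|) (-h + |t|) with hJ₁
  set J₂ : Set ℝ := Icc (h - |t|) (h + |t|) with hJ₂
  -- pointwise: the two indicators differ only within `|t|` of an endpoint
  have hpt : ∀ z, |1 / (2 * h) * (Icc (-h) h).indicator (fun _ ↦ (1 : ℝ)) (z + t)
        - 1 / (2 * h) * (Icc (-h) h).indicator (fun _ ↦ (1 : ℝ)) z|
      ≤ 1 / (2 * h) * (J₁.indicator (fun _ ↦ (1 : ℝ)) z + J₂.indicator (fun _ ↦ (1 : ℝ)) z) := by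
    intro z
    have ht1 := le_abs_self t
    have ht2 := neg_abs_le t
    have hJ0 : 0 ≤ J₁.indicator (fun _ ↦ (1 : ℝ)) z + J₂.indicator (fun _ ↦ (1 : ℝ)) z := by
      apply add_nonneg <;> exact Set.indicator_nonneg (fun _ _ ↦ zero_le_one) _
    rw [← mul_sub, abs_mul, abs_of_pos h2h]
    refine mul_le_mul_of_nonneg_left ?_ h2h.le
    by_cases hz : z ∈ Icc (-h) h <;> by_cases hzt : z + t ∈ Icc (-h) h
    · rw [indicator_of_mem hzt, indicator_of_mem hz, sub_self, abs_zero]; exact hJ0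
    · -- `z ∈ I`, `z + t ∉ I`: `z` is within `|t|` of an endpoint
      rw [indicator_of_notMem hzt, indicator_of_mem hz]
      simp only [zero_sub, abs_neg, abs_one]
      rw [mem_Icc, not_and_or, not_le, not_le] at hzt
      rcases hzt with hlt | hgt
      · have hz1 : z ∈ J₁ := ⟨by linarith [hz.1], by linarith⟩
        rw [indicator_of_mem hz1]
        linarith [Set.indicator_nonneg (fun _ _ ↦ (zero_le_one : (0 : ℝ) ≤ 1)) z (s := J₂)]
      · have hz2 : z ∈ J₂ := ⟨by linarith, by linarith [hz.2]⟩
        rw [indicator_of_mem hz2]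
        linarith [Set.indicator_nonneg (fun _ _ ↦ (zero_le_one : (0 : ℝ) ≤ 1)) z (s := J₁)]
    · rw [indicator_of_mem hzt, indicator_of_notMem hz]
      simp only [sub_zero, abs_one]
      rw [mem_Icc, not_and_or, not_le, not_le] at hz
      rcases hz with hlt | hgt
      · have hz1 : z ∈ J₁ := ⟨by linarith [hzt.1], by linarith⟩
        rw [indicator_of_mem hz1]
        linarith [Set.indicator_nonneg (fun _ _ ↦ (zero_le_one : (0 : ℝ) ≤ 1)) z (s := J₂)]
      · have hz2 : z ∈ J₂ := ⟨by linarith, by linarith [hzt.2]⟩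
        rw [indicator_of_mem hz2]
        linarith [Set.indicator_nonneg (fun _ _ ↦ (zero_le_one : (0 : ℝ) ≤ 1)) z (s := J₁)]
    · rw [indicator_of_notMem hzt, indicator_of_notMem hz, sub_self, abs_zero]; exact hJ0
  have hi1 : Integrable (J₁.indicator fun _ ↦ (1 : ℝ)) :=
    (integrable_indicator_iff measurableSet_Icc).2 (integrableOn_const (by simp [Real.volume_Icc]))
  have hi2 : Integrable (J₂.indicator fun _ ↦ (1 : ℝ)) :=
    (integrable_indicator_iff measurableSet_Icc).2 (integrableOn_const (by simp [Real.volume_Icc]))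
  have hv1 : ∫ z, J₁.indicator (fun _ ↦ (1 : ℝ)) z = 2 * |t| := by
    have e : J₁.indicator (fun _ ↦ (1 : ℝ)) = J₁.indicator 1 := rfl
    rw [e, integral_indicator_one measurableSet_Icc, Real.volume_real_Icc_of_le (by linarith [abs_nonneg t])]; ring
  have hv2 : ∫ z, J₂.indicator (fun _ ↦ (1 : ℝ)) z = 2 * |t| := by
    have e : J₂.indicator (fun _ ↦ (1 : ℝ)) = J₂.indicator 1 := rfl
    rw [e, integral_indicator_one measurableSet_Icc, Real.volume_real_Icc_of_le (by linarith [abs_nonneg t])]; ring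
  calc ∫ z, |1 / (2 * h) * (Icc (-h) h).indicator (fun _ ↦ (1 : ℝ)) (z + t)
          - 1 / (2 * h) * (Icc (-h) h).indicator (fun _ ↦ (1 : ℝ)) z|
      ≤ ∫ z, 1 / (2 * h) * (J₁.indicator (fun _ ↦ (1 : ℝ)) z + J₂.indicator (fun _ ↦ (1 : ℝ)) z) :=
        integral_mono_of_nonneg (Eventually.of_forall fun z ↦ abs_nonneg _) ((hi1.add hi2).const_mul _)
          (Eventually.of_forall hpt)
    _ = 1 / (2 * h) * (2 * |t| + 2 * |t|) := by rw [integral_const_mul, integral_add hi1 hi2, hv1, hv2]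
    _ = 2 * |t| / h := by field_simp; ring

/-- Increments of the box envelope `G = (φ_h ∗ g²)^{1/2}`: `∫ (G(x+t) − G(x))² ≤ min(2, 2|t|/h)·∫g²`. -/
theorem boxEnvelope_increment_le (hh : 0 < h) (hg : Measurable g) (hC : ∀ x, |g x| ≤ C)
    (hsupp : ∀ x, x ∉ Icc (-a) a → g x = 0) (t : ℝ) :
    ∫ x, (Real.sqrt (∫ z, 1 / (2 * h) * (Icc (-h) h).indicator (fun _ ↦ (1 : ℝ)) z * g (x + t - z) ^ 2)
        - Real.sqrt (∫ z, 1 / (2 * h) * (Icc (-h) h).indicator (fun _ ↦ (1 : ℝ)) z * g (x - z) ^ 2)) ^ 2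
      ≤ min 2 (2 * |t| / h) * ∫ x, g x ^ 2 := by
  obtain ⟨hφm, hφ0, hφC, hφs, hφ1⟩ := box_weight hh
  have hN : 0 ≤ ∫ x, g x ^ 2 := integral_nonneg fun x ↦ sq_nonneg _
  rcases le_total 2 (2 * |t| / h) with hmin | hmin
  · rw [min_eq_left hmin]
    exact integral_sq_envelope_sub_le_two_mul hg hC hsupp hφm hφ0 hφC hφs hφ1 t
  · rw [min_eq_right hmin]
    exact (integral_sq_envelope_sub_le hg hC hsupp hφm hφ0 hφC hφs t).trans
      (mul_le_mul_of_nonneg_right (box_weight_modulus hh t) hN)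

/-! ## §3 The package -/

/-- **Every window function has an `h`-regular majorant.**  For a real measurable bounded `g` vanishing off `[−a, a]` and `h > 0`
there is an admissible `G ≥ 0` on `[−(a+h), a+h]` (the box envelope) with `∫G² = ∫g²`, `Q_a(g) ≤ Q_{a+h}(G)`, and
`∫ (G(x+t) − G(x))² ≤ (|t|/(h/2))·∫G²` for every `t`. -/
theorem exists_boxEnvelope (hh : 0 < h) (hg : Measurable g) (hC : ∀ x, |g x| ≤ C)
    (hsupp : ∀ x, x ∉ Icc (-a) a → g x = 0) :
    ∃ G : ℝ → ℝ, Measurable G ∧ (∀ x, 0 ≤ G x) ∧ (∀ x, |G x| ≤ C) ∧ (∀ x, x ∉ Icc (-(a + h)) (a + h) → G x = 0) ∧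
      (∫ x, G x ^ 2 = ∫ x, g x ^ 2) ∧ primeShiftForm a g ≤ primeShiftForm (a + h) G ∧
      ∀ t, ∫ x, (G (x + t) - G x) ^ 2 ≤ |t| / (h / 2) * ∫ x, G x ^ 2 := by
  obtain ⟨hφm, hφ0, hφC, hφs, hφ1⟩ := box_weight hh
  set G : ℝ → ℝ := fun x ↦ Real.sqrt (∫ z, 1 / (2 * h) * (Icc (-h) h).indicator (fun _ ↦ (1 : ℝ)) z * g (x - z) ^ 2)
    with hGdef
  obtain ⟨hGm, hG0, hGb, hGs⟩ : Measurable G ∧ (∀ x, 0 ≤ G x) ∧ (∀ x, |G x| ≤ C) ∧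
      (∀ x, x ∉ Icc (-(a + h)) (a + h) → G x = 0) := envelope_admissible hg hC hsupp hφm hφ0 hφC hφs hφ1
  have hGN : ∫ x, G x ^ 2 = ∫ x, g x ^ 2 := integral_envelope_sq hg hC hsupp hφm hφ0 hφC hφs hφ1
  have hQ : primeShiftForm a g ≤ primeShiftForm (a + h) G := primeShiftForm_le_envelope hh.le hg hC hsupp hφm hφ0 hφC hφs hφ1
  have hinc : ∀ t, ∫ x, (G (x + t) - G x) ^ 2 ≤ |t| / (h / 2) * ∫ x, G x ^ 2 := fun t ↦ by
    have h1 : ∫ x, (G (x + t) - G x) ^ 2 ≤ min 2 (2 * |t| / h) * ∫ x, g x ^ 2 := boxEnvelope_increment_le hh hg hC hsupp t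
    rw [hGN]
    refine h1.trans (mul_le_mul_of_nonneg_right ((min_le_right _ _).trans (le_of_eq ?_)) (integral_nonneg fun x ↦ sq_nonneg _))
    field_simp
  exact ⟨G, hGm, hG0, hGb, hGs, hGN, hQ, hinc⟩

end FloorEnvelope

end Summit.RiemannHypothesis.RiemannHypothesis.Theorems.WeilFormatC
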